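import Literature.IUT.LogVolume.Theorem110RealStepII
import Literature.IUT.LogVolume.Corollary22LegendreDeepAdmissiblePairs
import Literature.NumberTheory.DiophantineGeometry.AbcWave0UniformABCProofs
import Mathlib.NumberTheory.Padics.HeightOneSpectrum
import HarnessLib

/-!
# [IUTchIV] Cor. 2.2 at RATIONAL points of the `λ`-line: the EXACT `q`-parameter / conductor dictionary
# (`log(q^{∤S})`, `log(𝔣^{∤S})` from a prime factorisation of the denominator of `j(λ)`) and a ONE-LINE Szpiro certificate

S. Mochizuki, *Inter-universal Teichmüller theory IV*, RIMS manuscript (Apr. 2020; = PRIMS **57** (2021)), Thm. 1.10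
p. 22–23 (`𝔮 = Σ h_v[v]`, `𝔣` "the effective arithmetic divisor whose support coincides with `Supp(𝔮)`, but all of whose
coefficients are equal to `1`"), Cor. 2.2 (i) p. 41 (`log(q^{∤2})`), (ii) proof p. 44 ("`h_v ∈ ℕ_{≥1}` is the local height of
`E_F`"), (P5) p. 46 (`S = {2, l}`); S. Mochizuki, *Arithmetic elliptic curves in general position*, Math. J. Okayama Univ. **52**
(2010), Ex. 1.3 (i) p. 5 (rational points), Def. 3.3 p. 12 (local heights); J. H. Silverman, *The Arithmetic of Elliptic Curves*,
VII.5.5 / C.14 (Tate: `−ord_v(j) =` the order of the `q`-parameter at a place of potentially multiplicative reduction).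

Proof-only file (cell abc-iut, seat abc-iut-c312-d1 gen 8, row «HEX-SZPIRO-KERNEL»; the NUM-side engine of R-W's
WINDOW-TABLE column «szpiro_margin»). Everything here is CLASSICAL arithmetic of `ℚ`; no side taken on [IUTchIII] Cor. 3.12.
For a rational number `λ = q` presented over `ℚ` (the tree's `ratPoint q`, `[IUTchIV]`'s `F_tpd = ℚ`, `d_mod = 1`) whose
`j`-invariant is written `j(q) = N / ∏_{p ∈ I} p^{e_p}` with `I` a finite set of primes, `e_p ≥ 1` and `p ∤ N` for `p ∈ I`
(the reduced denominator, factorised):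

* `Cor22.ord_natCast_eq_factorization` — `ord_v(n) = v_{p_v}(n)` at every finite place `v` of `ℚ` (`p_v` the prime under `v`);
* `Cor22.ord_jInv_ratPoint` — `ord_v j(q) = v_{p_v}(N) − e_{p_v}·[p_v ∈ I]`;
* `Cor22.ord_jInv_ratPoint_neg_iff` / `Cor22.localHeight_ratPoint_eq` — the bad places of `ratPoint q` (poles of `j`,
  `Cor22.mem_badPlaces_iff_ord_neg`) are EXACTLY the places over `I`, with local height `h_{p} = e_p`;
* `Cor22.image_natGenerator_badPlacesAvoid_ratPoint` — `𝕍^bad_mod` away from `S` is (over) `{p ∈ I : p ∤ s ∀ s ∈ S}`;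
  (J. Dupuy, A. Hilado, *Statement of Mochizuki's Cor. 3.12*, §2.4.2: normalised valuations — cited for `ord_v = v_p` on `ℚ`);
* **`Cor22.logQAvoid_ratPoint_eq_sum`**: `log q^{∤S}(q) = Σ_{p ∈ I, p ∤ S} e_p·log p`; **`Cor22.logCondAvoid_ratPoint_eq_sum`**:
  `log 𝔣^{∤S}(q) = Σ_{p ∈ I, p ∤ S} log p` — EXACT values (only `p ∤ N` for the `p ∈ I` away from `S` is needed, so the Frey
  formula `j(a/c) = 2⁸(a²−ac+c²)³/(abc)²` with `2 ∈ S` qualifies as displayed);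
* **`Cor22.logQAvoid_ratPoint_le_mul_logCondAvoid`** — if `∏_{p ∈ I, p∤S} p^{e_p} ≤ (∏_{p ∈ I, p∤S} p)^R` then
  `log q^{∤S} ≤ R·log 𝔣^{∤S}`: a Szpiro ratio certified by ONE inequality of natural numbers;
* **`Cor22.logQAvoid_ratPoint_le_mul_logCondAvoid_of_prime`** — UNIFORM IN THE PRIME `l`: if `2 ∉ I`, `p^R ≤ M·p^{e_p}` for
  `p ∈ I` and `D·M ≤ rad(D)^R` (`D = ∏ p^{e_p}`, `rad(D) = ∏ p`), then `log q^{∤2l}(q) ≤ R·log 𝔣^{∤2l}(q)` for EVERY prime `l`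
  (removing the place over `l` costs at most the factor `M`); with the exact values at `S = {2, l}`
  (`Cor22.logQAvoid_ratPoint_two_prime_eq_sum`, `Cor22.logCondAvoid_ratPoint_two_prime_eq_sum`: sums over `I ∖ {l}`).

Consumers: the HEX family `λ_k = 1/2 + 2/7^k` (Szpiro-GOOD certificates, `LDHGenuinePerImageSzpiroGoodHexFamily.lean`) and the
Szpiro-BAD guard of the cut certificates at Frey–Legendre points of known abc triples (R-W task «C:HSHW-REF»). No definitions,
no new named fact; nothing here asserts any clause of Cor. 2.2, the existence of Θ-data, or abc.
-/

noncomputable section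

namespace Literature.IUT.LogVolume

namespace Cor22

open NumberField IsDedekindDomain Literature.NumberTheory.DiophantineGeometry
open Literature.NumberTheory.DiophantineGeometry.GenEll
open Literature.NumberTheory.DiophantineGeometry.UniformABCConjecture Rat.HeightOneSpectrum

/-! ## 1. Valuations of natural numbers at the places of `ℚ` -/

/-- **`ord_v(n) = v_{p_v}(n)`** for `n ≠ 0` — the tree's `ord` at a finite place of `ℚ` IS the `p_v`-adic valuation (normalisation
«`ord_K(π_K) = 1`»; write `n = p^{v_p(n)}·m` with `p = p_v ∤ m`). [cite: DupuyHilado2025, §2.4.2] -/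
theorem ord_natCast_eq_factorization (v : HeightOneSpectrum (𝓞 ℚ)) {n : ℕ} (hn : n ≠ 0) :
    ord ℚ v (n : ℚ) = n.factorization (natGenerator v) := by
  set p := natGenerator v with hp
  have hpp : p.Prime := prime_natGenerator v
  set m := ordCompl[p] n with hm
  have hdec : (n : ℚ) = ((p : ℚ) ^ n.factorization p) * (m : ℚ) := by
    have h := Nat.ordProj_mul_ordCompl_eq_self n p
    rw [← hm] at h
    exact_mod_cast h.symm
  have hp0 : (p : ℚ) ≠ 0 := by exact_mod_cast hpp.ne_zero
  have hm0' : m ≠ 0 := (Nat.ordCompl_pos p hn).ne'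
  have hm0 : (m : ℚ) ≠ 0 := by exact_mod_cast hm0'
  have hpm : ¬ p ∣ m := Nat.not_dvd_ordCompl hpp hn
  have h1 : ord ℚ v (p : ℚ) = 1 := ord_natGenerator_eq_one v
  have h2 : ord ℚ v (m : ℚ) = 0 := by
    unfold ord
    rw [(valuation_natCast_eq_one_iff v m).2 hpm, WithZero.log_one, neg_zero]
  rw [hdec, ord_mul ℚ v (pow_ne_zero _ hp0) hm0, ord_pow, h1, h2, mul_one, add_zero]

/-- The prime under the place `primesEquiv⁻¹ p` is `p`. [folklore] -/
private theorem natGenerator_primesEquiv_symm {p : ℕ} (hp : p.Prime) :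
    natGenerator ((primesEquiv (R := 𝓞 ℚ)).symm ⟨p, hp⟩) = p :=
  congrArg Subtype.val ((primesEquiv (R := 𝓞 ℚ)).apply_symm_apply ⟨p, hp⟩)

/-- `log N(v) = log p_v` at a finite place of `ℚ`. [folklore] -/
private theorem logNorm_rat_eq (v : HeightOneSpectrum (𝓞 ℚ)) : logNorm ℚ v = Real.log (natGenerator v) := by
  rw [logNorm, absNorm_asIdeal_eq_natGenerator]

/-- `v_{p₀}(∏_{p ∈ I} p^{e_p}) = e_{p₀}·[p₀ ∈ I]` for a finite set `I` of primes. [folklore] -/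
private theorem factorization_prod_prime_pow {I : Finset ℕ} (hI : ∀ p ∈ I, p.Prime) (e : ℕ → ℕ) (p₀ : ℕ) :
    (∏ p ∈ I, p ^ e p).factorization p₀ = if p₀ ∈ I then e p₀ else 0 := by
  rw [Nat.factorization_prod_apply fun p hp => pow_ne_zero _ (hI p hp).ne_zero]
  rw [Finset.sum_congr rfl fun p hp => by rw [Nat.Prime.factorization_pow (hI p hp), Finsupp.single_apply]]
  exact Finset.sum_ite_eq' I p₀ e

/-! ## 2. The dictionary at a rational point `λ = q` with `j(q) = N / ∏_{p ∈ I} p^{e_p}` -/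

section Dictionary

variable {q : ℚ} {N D : ℕ} {I : Finset ℕ} {e : ℕ → ℕ}

/-- **`ord_v j(q) = v_{p_v}(N) − e_{p_v}·[p_v ∈ I]`** when `j(q) = N/D`, `D = ∏_{p∈I} p^{e_p}`, `N ≠ 0`.
[cite: MochizukiGenEll2010, Def. 3.3 p. 12] -/
theorem ord_jInv_ratPoint (hI : ∀ p ∈ I, p.Prime) (hD : D = ∏ p ∈ I, p ^ e p)
    (hj : jInv q = (N : ℚ) / (D : ℚ)) (hN : N ≠ 0) (v : HeightOneSpectrum (𝓞 ℚ)) :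
    ord ℚ v (jInv q) =
      (N.factorization (natGenerator v) : ℤ) - ((if natGenerator v ∈ I then e (natGenerator v) else 0 : ℕ) : ℤ) := by
  have hD0 : D ≠ 0 := by
    rw [hD]; exact Finset.prod_ne_zero_iff.2 fun p hp => pow_ne_zero _ (hI p hp).ne_zero
  have hN0 : (N : ℚ) ≠ 0 := by exact_mod_cast hN
  have hD0' : (D : ℚ) ≠ 0 := by exact_mod_cast hD0
  rw [hj, div_eq_mul_inv, ord_mul ℚ v hN0 (inv_ne_zero hD0'), ord_inv, ord_natCast_eq_factorization v hN,
    ord_natCast_eq_factorization v hD0, hD, factorization_prod_prime_pow hI]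
  ring

/-- At a place over `p ∈ I` with `p ∤ N`: **`ord_v j(q) = −e_p`**. [cite: MochizukiGenEll2010, Def. 3.3 p. 12] -/
theorem ord_jInv_ratPoint_of_mem (hI : ∀ p ∈ I, p.Prime) (hD : D = ∏ p ∈ I, p ^ e p)
    (hj : jInv q = (N : ℚ) / (D : ℚ)) (hN : N ≠ 0) (v : HeightOneSpectrum (𝓞 ℚ))
    (hv : natGenerator v ∈ I) (hcop : ¬ natGenerator v ∣ N) :
    ord ℚ v (jInv q) = -(e (natGenerator v) : ℤ) := by
  rw [ord_jInv_ratPoint hI hD hj hN v, Nat.factorization_eq_zero_of_not_dvd hcop, if_pos hv]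
  simp

/-- At a place over a prime `p ∉ I`: `ord_v j(q) = v_p(N) ≥ 0`. [cite: MochizukiGenEll2010, Def. 3.3 p. 12] -/
theorem ord_jInv_ratPoint_nonneg_of_not_mem (hI : ∀ p ∈ I, p.Prime) (hD : D = ∏ p ∈ I, p ^ e p)
    (hj : jInv q = (N : ℚ) / (D : ℚ)) (hN : N ≠ 0) (v : HeightOneSpectrum (𝓞 ℚ))
    (hv : natGenerator v ∉ I) : 0 ≤ ord ℚ v (jInv q) := by
  rw [ord_jInv_ratPoint hI hD hj hN v, if_neg hv]
  simp

/-- **The poles of `j(q)` are exactly the places over `I`**: `ord_v j(q) < 0 ↔ p_v ∈ I` (given `e_p ≥ 1`, `p ∤ N` on `I`; the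
coprimality is used only at `p_v`). With `Cor22.mem_badPlaces_iff_ord_neg` this identifies `badPlaces (ratPoint q)`.
[cite: MochizukiGenEll2010, Def. 3.3 p. 12] -/
theorem ord_jInv_ratPoint_neg_iff (hI : ∀ p ∈ I, p.Prime) (he : ∀ p ∈ I, e p ≠ 0) (hD : D = ∏ p ∈ I, p ^ e p)
    (hj : jInv q = (N : ℚ) / (D : ℚ)) (hN : N ≠ 0) (v : HeightOneSpectrum (𝓞 ℚ))
    (hcop : natGenerator v ∈ I → ¬ natGenerator v ∣ N) :
    ord ℚ v (jInv q) < 0 ↔ natGenerator v ∈ I := by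
  constructor
  · intro h
    by_contra hv
    exact absurd h (not_lt.2 (ord_jInv_ratPoint_nonneg_of_not_mem hI hD hj hN v hv))
  · intro hv
    rw [ord_jInv_ratPoint_of_mem hI hD hj hN v hv (hcop hv)]
    have := Nat.pos_of_ne_zero (he _ hv)
    omega

/-- **The local height at a place over `p ∈ I` with `p ∤ N` is `e_p`** (`h_v = −ord_v j`, [GenEll] Def. 3.3 / [IUTchIV] p. 44).
[cite: MochizukiGenEll2010, Def. 3.3 p. 12] -/
theorem localHeight_ratPoint_eq (hI : ∀ p ∈ I, p.Prime) (hD : D = ∏ p ∈ I, p ^ e p)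
    (hj : jInv q = (N : ℚ) / (D : ℚ)) (hN : N ≠ 0) (v : HeightOneSpectrum (𝓞 ℚ))
    (hv : natGenerator v ∈ I) (hcop : ¬ natGenerator v ∣ N) :
    localHeight (ratPoint q) v = e (natGenerator v) := by
  have hord := ord_jInv_ratPoint_of_mem hI hD hj hN v hv hcop
  change (((-(ord ℚ v (jInv q))).toNat : ℕ) : ℝ) = _
  rw [hord, neg_neg, Int.toNat_natCast]

/-- At a place over a prime `p ∉ I` the local height vanishes. [cite: MochizukiGenEll2010, Def. 3.3 p. 12] -/
theorem localHeight_ratPoint_eq_zero (hI : ∀ p ∈ I, p.Prime) (hD : D = ∏ p ∈ I, p ^ e p)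
    (hj : jInv q = (N : ℚ) / (D : ℚ)) (hN : N ≠ 0) (v : HeightOneSpectrum (𝓞 ℚ))
    (hv : natGenerator v ∉ I) : localHeight (ratPoint q) v = 0 := by
  have hord := ord_jInv_ratPoint_nonneg_of_not_mem hI hD hj hN v hv
  change (((-(ord ℚ v (jInv q))).toNat : ℕ) : ℝ) = 0
  rw [Int.toNat_of_nonpos (by linarith)]
  simp

/-- A place of `ratPoint q` in `𝕍^bad_mod` away from `S` lies over a prime `p ∈ I` dividing no element of `S` (no coprimality
needed). [cite: Mochizuki2012, IUTchIV Cor 2.2 (ii) proof (P5) p.46] -/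
theorem natGenerator_mem_of_mem_badPlacesAvoid_ratPoint (hI : ∀ p ∈ I, p.Prime) (hD : D = ∏ p ∈ I, p ^ e p)
    (hj : jInv q = (N : ℚ) / (D : ℚ)) (hN : N ≠ 0) (S : Finset ℕ) {v : HeightOneSpectrum (𝓞 ℚ)}
    (hv : v ∈ badPlacesAvoid (ratPoint q) S) :
    natGenerator v ∈ I ∧ ∀ s ∈ S, ¬ natGenerator v ∣ s := by
  classical
  have h := Finset.mem_filter.1 hv
  have h1 := (mem_badPlaces_iff_ord_neg (ratPoint q) v).1 h.1
  change ord ℚ v (jInv q) < 0 at h1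
  refine ⟨?_, fun s hs hd => h.2 s hs ((natCast_mem_asIdeal_iff v s).2 hd)⟩
  by_contra hvI
  exact absurd h1 (not_lt.2 (ord_jInv_ratPoint_nonneg_of_not_mem hI hD hj hN v hvI))

/-- Conversely, the place over a prime `p ∈ I` with `p ∤ N` dividing no element of `S` lies in `𝕍^bad_mod` away from `S`.
[cite: Mochizuki2012, IUTchIV Cor 2.2 (ii) proof (P5) p.46] -/
theorem primesEquiv_symm_mem_badPlacesAvoid_ratPoint (hI : ∀ p ∈ I, p.Prime) (he : ∀ p ∈ I, e p ≠ 0)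
    (hD : D = ∏ p ∈ I, p ^ e p) (hj : jInv q = (N : ℚ) / (D : ℚ)) (hN : N ≠ 0) (S : Finset ℕ) {p : ℕ}
    (hpI : p ∈ I) (hcop : ¬ p ∣ N) (hpS : ∀ s ∈ S, ¬ p ∣ s) :
    (primesEquiv (R := 𝓞 ℚ)).symm ⟨p, hI p hpI⟩ ∈ badPlacesAvoid (ratPoint q) S := by
  classical
  set v := (primesEquiv (R := 𝓞 ℚ)).symm ⟨p, hI p hpI⟩ with hvdef
  have hgen : natGenerator v = p := natGenerator_primesEquiv_symm (hI p hpI)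
  refine Finset.mem_filter.2 ⟨(mem_badPlaces_iff_ord_neg (ratPoint q) v).2 ?_, fun s hs h => ?_⟩
  · change ord ℚ v (jInv q) < 0
    exact (ord_jInv_ratPoint_neg_iff hI he hD hj hN v (fun _ => by rw [hgen]; exact hcop)).2
      (by rw [hgen]; exact hpI)
  · have h' := (natCast_mem_asIdeal_iff v s).1 h
    rw [hgen] at h'
    exact hpS s hs h'

/-- **`𝕍^bad_mod` away from `S`, as a set of primes**: the primes under the bad places of `ratPoint q` not dividing the
elements of `S` are exactly `{p ∈ I : p ∤ s for all s ∈ S}` (coprimality `p ∤ N` needed only there).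
[cite: Mochizuki2012, IUTchIV Cor 2.2 (ii) proof (P5) p.46] -/
theorem image_natGenerator_badPlacesAvoid_ratPoint (hI : ∀ p ∈ I, p.Prime) (he : ∀ p ∈ I, e p ≠ 0)
    (hD : D = ∏ p ∈ I, p ^ e p) (hj : jInv q = (N : ℚ) / (D : ℚ)) (hN : N ≠ 0) (S : Finset ℕ)
    (hcop : ∀ p ∈ I, (∀ s ∈ S, ¬ p ∣ s) → ¬ p ∣ N) :
    (badPlacesAvoid (ratPoint q) S).image (natGenerator (R := 𝓞 ℚ)) = I.filter (fun p => ∀ s ∈ S, ¬ p ∣ s) := by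
  classical
  ext p
  constructor
  · intro hp
    obtain ⟨v, hv, hvp⟩ := Finset.mem_image.1 hp
    obtain ⟨h1, h2⟩ := natGenerator_mem_of_mem_badPlacesAvoid_ratPoint hI hD hj hN S hv
    rw [hvp] at h1 h2
    exact Finset.mem_filter.2 ⟨h1, h2⟩
  · intro hp
    obtain ⟨hpI, hpS⟩ := Finset.mem_filter.1 hp
    exact Finset.mem_image.2 ⟨_, primesEquiv_symm_mem_badPlacesAvoid_ratPoint hI he hD hj hN S hpI (hcop p hpI hpS) hpS,
      natGenerator_primesEquiv_symm (hI p hpI)⟩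

/-- **`log q^{∤S}(q) = Σ_{p ∈ I, p ∤ S} e_p·log p`** — the EXACT `q`-parameter term of [IUTchIV] Thm. 1.10 / Cor. 2.2 at a rational
point (`[F_tpd : ℚ] = 1`, `h_p = e_p`, `log N(v) = log p`). [cite: Mochizuki2012, IUTchIV Thm 1.10 p.23] -/
theorem logQAvoid_ratPoint_eq_sum (hI : ∀ p ∈ I, p.Prime) (he : ∀ p ∈ I, e p ≠ 0)
    (hD : D = ∏ p ∈ I, p ^ e p) (hj : jInv q = (N : ℚ) / (D : ℚ)) (hN : N ≠ 0) (S : Finset ℕ)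
    (hcop : ∀ p ∈ I, (∀ s ∈ S, ¬ p ∣ s) → ¬ p ∣ N) :
    logQAvoid (ratPoint q) S = ∑ p ∈ I.filter (fun p => ∀ s ∈ S, ¬ p ∣ s), (e p : ℝ) * Real.log p := by
  classical
  have h := degree_mul_logQAvoid (ratPoint q) S
  rw [degree_ratPoint, Nat.cast_one, one_mul] at h
  rw [h, ← image_natGenerator_badPlacesAvoid_ratPoint hI he hD hj hN S hcop,
    Finset.sum_image fun v _ w _ hvw => natGenerator_injective hvw]
  refine Finset.sum_congr rfl fun v hv => ?_
  obtain ⟨hmem, hS⟩ := natGenerator_mem_of_mem_badPlacesAvoid_ratPoint hI hD hj hN S hv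
  have hln : logNorm (ratPoint q).F v = Real.log (natGenerator (R := 𝓞 ℚ) v) := logNorm_rat_eq v
  rw [localHeight_ratPoint_eq hI hD hj hN v hmem (hcop _ hmem hS), hln]

/-- **`log 𝔣^{∤S}(q) = Σ_{p ∈ I, p ∤ S} log p`** — the EXACT conductor term at a rational point. [cite: Mochizuki2012, IUTchIV Thm 1.10 p.23] -/
theorem logCondAvoid_ratPoint_eq_sum (hI : ∀ p ∈ I, p.Prime) (he : ∀ p ∈ I, e p ≠ 0)
    (hD : D = ∏ p ∈ I, p ^ e p) (hj : jInv q = (N : ℚ) / (D : ℚ)) (hN : N ≠ 0) (S : Finset ℕ)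
    (hcop : ∀ p ∈ I, (∀ s ∈ S, ¬ p ∣ s) → ¬ p ∣ N) :
    logCondAvoid (ratPoint q) S = ∑ p ∈ I.filter (fun p => ∀ s ∈ S, ¬ p ∣ s), Real.log p := by
  classical
  have h := logCondAvoid_eq_sum (ratPoint q) S
  rw [degree_ratPoint, Nat.cast_one, inv_one, one_mul] at h
  rw [h, ← image_natGenerator_badPlacesAvoid_ratPoint hI he hD hj hN S hcop,
    Finset.sum_image fun v _ w _ hvw => natGenerator_injective hvw]
  refine Finset.sum_congr rfl fun v _ => ?_
  exact congrArg (fun n : ℕ => Real.log (n : ℝ)) (absNorm_asIdeal_eq_natGenerator v)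

/-- **A Szpiro ratio from ONE inequality of natural numbers**: if `∏_{p ∈ I, p∤S} p^{e_p} ≤ (∏_{p ∈ I, p∤S} p)^R` then
`log q^{∤S}(q) ≤ R·log 𝔣^{∤S}(q)`. [cite: Mochizuki2012, IUTchIV Thm 1.10 p.23] -/
theorem logQAvoid_ratPoint_le_mul_logCondAvoid (hI : ∀ p ∈ I, p.Prime) (he : ∀ p ∈ I, e p ≠ 0)
    (hD : D = ∏ p ∈ I, p ^ e p) (hj : jInv q = (N : ℚ) / (D : ℚ)) (hN : N ≠ 0) (S : Finset ℕ)
    (hcop : ∀ p ∈ I, (∀ s ∈ S, ¬ p ∣ s) → ¬ p ∣ N) (R : ℕ)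
    (hineq : ∏ p ∈ I.filter (fun p => ∀ s ∈ S, ¬ p ∣ s), p ^ e p ≤
      (∏ p ∈ I.filter (fun p => ∀ s ∈ S, ¬ p ∣ s), p) ^ R) :
    logQAvoid (ratPoint q) S ≤ R * logCondAvoid (ratPoint q) S := by
  classical
  set T := I.filter (fun p => ∀ s ∈ S, ¬ p ∣ s) with hT
  have hTpos : ∀ p ∈ T, 0 < p := fun p hp => (hI p (Finset.mem_filter.1 hp).1).pos
  rw [logQAvoid_ratPoint_eq_sum hI he hD hj hN S hcop, logCondAvoid_ratPoint_eq_sum hI he hD hj hN S hcop]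
  have h1 : ∑ p ∈ T, (e p : ℝ) * Real.log p = Real.log (((∏ p ∈ T, p ^ e p : ℕ)) : ℝ) := by
    rw [Nat.cast_prod, Real.log_prod fun p hp => ?_]
    · exact Finset.sum_congr rfl fun p _ => by rw [Nat.cast_pow, Real.log_pow]
    · exact_mod_cast (pow_pos (hTpos p hp) _).ne'
  have h2 : (R : ℝ) * ∑ p ∈ T, Real.log p = Real.log ((((∏ p ∈ T, p) ^ R : ℕ)) : ℝ) := by
    rw [Nat.cast_pow, Real.log_pow, Nat.cast_prod, Real.log_prod fun p hp => ?_]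
    exact_mod_cast (hTpos p hp).ne'
  rw [h1, h2]
  have hpos : (0 : ℝ) < ((∏ p ∈ T, p ^ e p : ℕ) : ℝ) := by
    exact_mod_cast Finset.prod_pos fun p hp => pow_pos (hTpos p hp) _
  exact Real.log_le_log hpos (by exact_mod_cast hineq)

end Dictionary

/-! ## 3. Uniformity in the prime `l`: `S = {2, l}` -/

/-- The elements of `{2, l}`. [folklore] -/
private theorem mem_pair_two (l : ℕ) : l ∈ ({2, l} : Finset ℕ) ∧ ∀ s ∈ ({2, l} : Finset ℕ), s = 2 ∨ s = l := by
  refine ⟨Finset.mem_insert_of_mem (Finset.mem_singleton_self l), fun s hs => ?_⟩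
  rcases Finset.mem_insert.1 hs with h | h
  · exact Or.inl h
  · exact Or.inr (Finset.mem_singleton.1 h)

/-- For a set `I` of odd primes, a prime `l` and `S ⊆ {2, l}` containing `l`: `{p ∈ I : p ∤ s ∀ s ∈ S} = I ∖ {l}`. [folklore] -/
private theorem filter_not_dvd_eq_erase {I : Finset ℕ} (hI : ∀ p ∈ I, p.Prime) (h2 : 2 ∉ I) {l : ℕ} (hl : l.Prime)
    (S : Finset ℕ) (hlS : l ∈ S) (hS : ∀ s ∈ S, s = 2 ∨ s = l) :
    I.filter (fun p => ∀ s ∈ S, ¬ p ∣ s) = I.erase l := by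
  ext p
  constructor
  · intro hp
    obtain ⟨hpI, hpS⟩ := Finset.mem_filter.1 hp
    have hl' : ¬ p ∣ l := hpS l hlS
    exact Finset.mem_erase.2 ⟨fun h => hl' (h ▸ dvd_rfl), hpI⟩
  · intro hp
    obtain ⟨hpl, hpI⟩ := Finset.mem_erase.1 hp
    have hpp := hI p hpI
    refine Finset.mem_filter.2 ⟨hpI, ?_⟩
    intro s hs hd
    rcases hS s hs with h | h
    · rw [h] at hd
      exact h2 (((Nat.prime_dvd_prime_iff_eq hpp Nat.prime_two).1 hd) ▸ hpI)
    · rw [h] at hd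
      exact hpl ((Nat.prime_dvd_prime_iff_eq hpp hl).1 hd)

/-- **Removing one prime costs at most the factor `M`**: if `p^R ≤ M·p^{e_p}` for every `p ∈ I` and `(∏_I p^{e_p})·M ≤ (∏_I p)^R`,
then `∏_{I∖{r}} p^{e_p} ≤ (∏_{I∖{r}} p)^R` for EVERY `r`. [folklore] -/
private theorem prod_pow_erase_le_pow {I : Finset ℕ} {e : ℕ → ℕ} {R M : ℕ} (hpos : ∀ p ∈ I, 0 < p) (hM0 : 0 < M)
    (hM : ∀ p ∈ I, p ^ R ≤ M * p ^ e p) (hmain : (∏ p ∈ I, p ^ e p) * M ≤ (∏ p ∈ I, p) ^ R) (r : ℕ) :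
    ∏ p ∈ I.erase r, p ^ e p ≤ (∏ p ∈ I.erase r, p) ^ R := by
  by_cases hr : r ∈ I
  · have hr0 : 0 < r := hpos r hr
    have e1 := Finset.mul_prod_erase I (fun p => p ^ e p) hr
    have e2 := Finset.mul_prod_erase I (fun p => p) hr
    rw [← e1, ← e2, mul_pow] at hmain
    have key : (∏ p ∈ I.erase r, p ^ e p) * r ^ R ≤ (∏ p ∈ I.erase r, p) ^ R * r ^ R :=
      calc (∏ p ∈ I.erase r, p ^ e p) * r ^ R
          ≤ (∏ p ∈ I.erase r, p ^ e p) * (M * r ^ e r) := Nat.mul_le_mul_left _ (hM r hr)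
        _ = r ^ e r * (∏ p ∈ I.erase r, p ^ e p) * M := by ring
        _ ≤ r ^ R * (∏ p ∈ I.erase r, p) ^ R := hmain
        _ = (∏ p ∈ I.erase r, p) ^ R * r ^ R := by ring
    exact Nat.le_of_mul_le_mul_right key (pow_pos hr0 R)
  · rw [Finset.erase_eq_of_notMem hr]
    exact le_trans (Nat.le_mul_of_pos_right _ hM0) hmain

section Prime

variable {q : ℚ} {N D : ℕ} {I : Finset ℕ} {e : ℕ → ℕ}

/-- **`log q^{∤2l}(q) = Σ_{p ∈ I ∖ {l}} e_p·log p`** for a prime `l`, when the primes of `I` are odd and coprime to `N`.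
[cite: Mochizuki2012, IUTchIV Cor 2.2 (ii) proof (P5) p.46] -/
theorem logQAvoid_ratPoint_two_prime_eq_sum (hI : ∀ p ∈ I, p.Prime) (he : ∀ p ∈ I, e p ≠ 0)
    (hD : D = ∏ p ∈ I, p ^ e p) (hj : jInv q = (N : ℚ) / (D : ℚ)) (hN : N ≠ 0)
    (hcop : ∀ p ∈ I, ¬ p ∣ N) (h2 : 2 ∉ I) {l : ℕ} (hl : l.Prime) :
    logQAvoid (ratPoint q) {2, l} = ∑ p ∈ I.erase l, (e p : ℝ) * Real.log p := by
  rw [logQAvoid_ratPoint_eq_sum hI he hD hj hN {2, l} fun p hp _ => hcop p hp,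
    filter_not_dvd_eq_erase hI h2 hl {2, l} (mem_pair_two l).1 (mem_pair_two l).2]

/-- **`log 𝔣^{∤2l}(q) = Σ_{p ∈ I ∖ {l}} log p`** for a prime `l` (same hypotheses). [cite: Mochizuki2012, IUTchIV Cor 2.2 (ii) proof (P5) p.46] -/
theorem logCondAvoid_ratPoint_two_prime_eq_sum (hI : ∀ p ∈ I, p.Prime) (he : ∀ p ∈ I, e p ≠ 0)
    (hD : D = ∏ p ∈ I, p ^ e p) (hj : jInv q = (N : ℚ) / (D : ℚ)) (hN : N ≠ 0)
    (hcop : ∀ p ∈ I, ¬ p ∣ N) (h2 : 2 ∉ I) {l : ℕ} (hl : l.Prime) :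
    logCondAvoid (ratPoint q) {2, l} = ∑ p ∈ I.erase l, Real.log p := by
  rw [logCondAvoid_ratPoint_eq_sum hI he hD hj hN {2, l} fun p hp _ => hcop p hp,
    filter_not_dvd_eq_erase hI h2 hl {2, l} (mem_pair_two l).1 (mem_pair_two l).2]

/-- **THE UNIFORM SZPIRO CERTIFICATE**: `j(q) = N/D`, `D = ∏_{p∈I} p^{e_p}` over odd primes `p ∤ N` with `e_p ≥ 1`; if
`p^R ≤ M·p^{e_p}` for all `p ∈ I` and `D·M ≤ (∏_{p∈I} p)^R`, then **`log q^{∤2l}(q) ≤ R·log 𝔣^{∤2l}(q)` for EVERY prime `l`**.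
[cite: Mochizuki2012, IUTchIV Thm 1.10 p.23] -/
theorem logQAvoid_ratPoint_le_mul_logCondAvoid_of_prime (hI : ∀ p ∈ I, p.Prime) (he : ∀ p ∈ I, e p ≠ 0)
    (hD : D = ∏ p ∈ I, p ^ e p) (hj : jInv q = (N : ℚ) / (D : ℚ)) (hN : N ≠ 0)
    (hcop : ∀ p ∈ I, ¬ p ∣ N) (h2 : 2 ∉ I) {R M : ℕ} (hM0 : 0 < M) (hM : ∀ p ∈ I, p ^ R ≤ M * p ^ e p)
    (hmain : D * M ≤ (∏ p ∈ I, p) ^ R) {l : ℕ} (hl : l.Prime) :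
    logQAvoid (ratPoint q) {2, l} ≤ R * logCondAvoid (ratPoint q) {2, l} := by
  refine logQAvoid_ratPoint_le_mul_logCondAvoid hI he hD hj hN {2, l} (fun p hp _ => hcop p hp) R ?_
  rw [filter_not_dvd_eq_erase hI h2 hl {2, l} (mem_pair_two l).1 (mem_pair_two l).2]
  rw [hD] at hmain
  exact prod_pow_erase_le_pow (fun p hp => (hI p hp).pos) hM0 hM hmain l

end Prime

end Cor22

end Literature.IUT.LogVolume

end
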